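import Literature.AnabelianGeometry.EtaleTheta.ClassicalTheta
import HarnessLib

/-!
# [EtTh] §1: the value of the classical theta series at `√−1` (Def. 1.9 (ii))

Mochizuki, *The étale theta function …*, Publ. RIMS **45** (2009), §1, Def. 1.9 (ii), PRIMS PDF p. 29
(printed 255) refers to "the value at `√−1` of the series representation of `Θ̈` given in Proposition
1.4" [cite: MochizukiEtTh2009, Def 1.9 (ii) p.29]: the standard sets of values of the étale theta class
are the values at the 4-torsion points `τ^{±1}` with `Ü(τ) = √−1`, and "standard type" normalises the
value of maximal order to `±1`. This file computes that value from `ClassicalTheta.thetaDdot`: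
`Θ̈(i) = i · Σ_{n ∈ ℤ} q̈^{n(n+1)}` for any `i` with `i² = −1` (PROVED, any normed field, no convergence
hypothesis needed — a termwise identity). Seat abc-iut-L2-t1 (layer L2 of the abc-iut cell).
Nothing disputed is touched; no statement of the paper is strengthened.
-/

namespace Literature.AnabelianGeometry.EtaleTheta

variable {𝕜 : Type*} [NormedField 𝕜]

/-- At a square root `i` of `−1` the general term of `Θ̈` is `i · q̈^{n(n+1)}`: the signs `(-1)^n` and
`i^{2n} = (-1)^n` cancel. [cite: MochizukiEtTh2009, Def 1.9 (ii) p.29] -/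
theorem thetaDdotTerm_sqrt_neg_one {i : 𝕜} (hi : i ^ 2 = -1) (q2 : 𝕜) (n : ℤ) :
    thetaDdotTerm q2 i n = i * q2 ^ (n * (n + 1)) := by
  have hi0 : i ≠ 0 := by
    rintro rfl
    norm_num at hi
  have h1 : ((-1 : 𝕜)) ^ n * (-1 : 𝕜) ^ n = 1 := by
    rw [← zpow_add₀ (neg_ne_zero.mpr one_ne_zero), Even.neg_one_zpow ⟨n, rfl⟩]
  have h2 : i ^ (2 * n + 1) = (-1 : 𝕜) ^ n * i := by
    rw [zpow_add₀ hi0, zpow_one, zpow_mul, ← hi]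
    norm_cast
  rw [thetaDdotTerm, Int.cast_negOnePow, h2]
  linear_combination (q2 ^ (n * (n + 1)) * i) * h1

/-- **The value of `Θ̈` at `√−1`** ("the value at `√−1` of the series representation of `Θ̈` given in
Proposition 1.4", Def. 1.9 (ii), p. 29): `Θ̈(i) = i · Σ_{n ∈ ℤ} q̈^{n(n+1)}` for `i² = −1` — the series
`2i(1 + q̈² + q̈⁶ + …)` behind the "`±1`" normalisation of *standard type* (a unit times `2`, so a unit
exactly in odd residue characteristic, cf. Thm. 1.10 (iii)). PROVED. [cite: MochizukiEtTh2009, Def 1.9 (ii) p.29] -/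
theorem thetaDdot_sqrt_neg_one {i : 𝕜} (hi : i ^ 2 = -1) (q2 : 𝕜) :
    thetaDdot q2 i = i * ∑' n : ℤ, q2 ^ (n * (n + 1)) := by
  unfold thetaDdot
  rw [← tsum_mul_left]
  exact tsum_congr fun n => thetaDdotTerm_sqrt_neg_one hi q2 n

end Literature.AnabelianGeometry.EtaleTheta
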